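import Literature.Combinatorics.SetFamily.CubeMiddleLayerLoss
import Literature.Combinatorics.SetFamily.CubeMiddleLayerBounds
import Mathlib.Analysis.SpecialFunctions.Pow.Real
import Mathlib.Analysis.SpecialFunctions.Log.Base
import HarnessLib

/-!
# The middle-layer family with thresholds in `n`: a thin common layer of `n^{-r}`-small per-member loss

The assembled statement used by the Summits-side refutation of the Alekseev–Gaevoy union-stability
statement for affine subspaces of `𝔽₂ⁿ` (ECCC TR26-007, §1.2 (1.4) = §4 (4.2) [AlekseevGaevoy2026b];
typed and refuted in `Summits/PneNP/PneNP/Theorems/ResLinUnionStability.lean`): `middle_layer_instance` —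
for every `r > 0` and `c > 0` there is `N` such that for EVERY `n ≥ N`, with `k = ⌈r·log₂ n⌉` and a
coordinate set `A` of size `2k`, the `C(2k,k)` subcubes `Φ_S = {x_S = 1}`, `S ∈ (A choose k)`, are affine
flats of codimension exactly `k`, their union has `≥ 2^{n-1}` points, the survivors `Φ_S ∖ {wt_A = k}`
satisfy `|Φ'_S| ≥ (1 − n^{-r})|Φ_S|`, and yet `|⋃ Φ'_S| ≤ (1 − 1/(2√k))·|⋃ Φ_S| < (1 − n^{-rc})·|⋃ Φ_S|`.
Side conditions placing `k` inside a codimension budget `(log₂ n)^q`: `side_condition_of_one_lt`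
(`q > 1`), `side_condition_of_lt_one` (`q = 1`, `r < 1`). Numeric thresholds use only `1 + x ≤ exp x`
(`rpow_beats_linear`, `logb_threshold`).

-- adapted from reserve/prior-2001/Prior/PneNP/PneNP/Pnp_Y3DaglikeReslinWidthAndLayerCounting_MiddleLayerCounterexample.lean
-- (internal 2001 programme, route y3, manuscript "The middle layer of the cube refutes a union-stability
-- conjecture for affine subspaces", v2 6c855445, 2026-08; unpublished, NOT cited as a source anywhere in
-- the tree); proofs unchanged (one unused hypothesis of `rpow_beats_linear` dropped), docstrings adapted.
-/

namespace Literature.Combinatorics.SetFamily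

open Finset

namespace CubeMiddleLayer

variable {n : ℕ}

/-- The indexed union of the members `Φ_S`, `S ∈ (A choose d)`, is `U`. [folklore] -/
lemma iUnion_Phi_eq (A : Finset (Fin n)) (d : ℕ) :
    (⋃ i : {S : Finset (Fin n) // S ∈ Finset.powersetCard d A},
      (↑(Phi i.1) : Set (V n))) = ↑(Uset A d) := by
  ext x
  simp only [Set.mem_iUnion, Finset.mem_coe, Uset, Finset.mem_biUnion]
  constructor
  · rintro ⟨⟨S, hS⟩, hx⟩
    exact ⟨S, hS, hx⟩
  · rintro ⟨S, hS, hx⟩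
    exact ⟨⟨S, hS⟩, hx⟩

/-- The indexed union of the survivors `Φ'_S`, `S ∈ (A choose d)`, is `U'`. [folklore] -/
lemma iUnion_PhiP_eq (A : Finset (Fin n)) (d : ℕ) :
    (⋃ i : {S : Finset (Fin n) // S ∈ Finset.powersetCard d A},
      (↑(PhiP A d i.1) : Set (V n))) = ↑(U'set A d) := by
  ext x
  simp only [Set.mem_iUnion, Finset.mem_coe, U'set, Finset.mem_biUnion]
  constructor
  · rintro ⟨⟨S, hS⟩, hx⟩
    exact ⟨S, hS, hx⟩
  · rintro ⟨S, hS, hx⟩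
    exact ⟨⟨S, hS⟩, hx⟩

/-! ### Numeric helpers for the thresholds (no transcendental machinery beyond
`1 + x + x²/2 ≤ exp x`, Mathlib's `Real.quadratic_le_exp_of_nonneg`) -/

/-- Exponential growth beats linear, with an explicit real threshold:
for `t > 0` and any real `a`, past `L₀ ≥ 1` one has `a·L + 2 < 2^(t·L)`. [folklore] -/
lemma rpow_beats_linear (t a : ℝ) (ht : 0 < t) :
    ∃ L₀ : ℝ, 1 ≤ L₀ ∧ ∀ L : ℝ, L₀ ≤ L → a * L + 2 < (2 : ℝ) ^ (t * L) := by
  have hlog : 0 < Real.log 2 := Real.log_pos one_lt_two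
  have hcpos : 0 < t * Real.log 2 := mul_pos ht hlog
  refine ⟨max 1 (4 * (a + 2) / (t * Real.log 2) ^ 2 + 1), le_max_left _ _, fun L hL => ?_⟩
  have hL1 : 1 ≤ L := le_trans (le_max_left _ _) hL
  have hLpos : 0 < L := by linarith
  have hLc : 4 * (a + 2) / (t * Real.log 2) ^ 2 + 1 ≤ L := le_trans (le_max_right _ _) hL
  have hkey : a + 2 < (t * Real.log 2) ^ 2 * L / 4 := by
    have h1 : 4 * (a + 2) / (t * Real.log 2) ^ 2 < L := by linarith
    have h2 : 4 * (a + 2) < L * (t * Real.log 2) ^ 2 := by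
      rwa [div_lt_iff₀ (by positivity)] at h1
    nlinarith
  have hchain : a * L + 2 < (t * Real.log 2) ^ 2 * L ^ 2 / 4 := by
    have h1 : a * L + 2 ≤ (a + 2) * L := by nlinarith
    have h2 : (a + 2) * L < ((t * Real.log 2) ^ 2 * L / 4) * L :=
      mul_lt_mul_of_pos_right hkey hLpos
    calc a * L + 2 ≤ (a + 2) * L := h1
    _ < ((t * Real.log 2) ^ 2 * L / 4) * L := h2
    _ = (t * Real.log 2) ^ 2 * L ^ 2 / 4 := by ring
  have hexp : (t * Real.log 2) ^ 2 * L ^ 2 / 4 ≤ Real.exp ((t * Real.log 2) * L) := by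
    have h : ((t * Real.log 2) * L) ^ 2 / 4 ≤ Real.exp ((t * Real.log 2) * L) := by
      have hq := Real.quadratic_le_exp_of_nonneg (show (0:ℝ) ≤ (t * Real.log 2) * L by positivity)
      nlinarith [sq_nonneg ((t * Real.log 2) * L)]
    calc (t * Real.log 2) ^ 2 * L ^ 2 / 4 = ((t * Real.log 2) * L) ^ 2 / 4 := by ring
    _ ≤ Real.exp ((t * Real.log 2) * L) := h
  have hrpow : (2 : ℝ) ^ (t * L) = Real.exp ((t * Real.log 2) * L) := by
    rw [Real.rpow_def_of_pos (by norm_num : (0:ℝ) < 2)]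
    congr 1
    ring
  rw [hrpow]
  linarith

/-- Past an explicit `N`, `logb 2 n` clears any given real threshold. [folklore] -/
lemma logb_threshold (L₀ : ℝ) :
    ∃ N : ℕ, 2 ≤ N ∧ ∀ n : ℕ, N ≤ n → L₀ ≤ Real.logb 2 n := by
  refine ⟨max 2 (⌈(2 : ℝ) ^ L₀⌉₊ + 1), le_max_left _ _, fun n hn => ?_⟩
  have hn2 : 2 ≤ n := le_trans (le_max_left _ _) hn
  have hnpos : (0 : ℝ) < n := by exact_mod_cast (by omega : 0 < n)
  rw [Real.le_logb_iff_rpow_le one_lt_two hnpos]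
  have h1 : (2 : ℝ) ^ L₀ ≤ (⌈(2 : ℝ) ^ L₀⌉₊ : ℝ) := Nat.le_ceil _
  have h2 : ⌈(2 : ℝ) ^ L₀⌉₊ + 1 ≤ n := le_trans (le_max_right _ _) hn
  have h3 : ((⌈(2 : ℝ) ^ L₀⌉₊ + 1 : ℕ) : ℝ) ≤ (n : ℝ) := by exact_mod_cast h2
  push_cast at h3
  linarith

/-- **The middle-layer family with thresholds.**  For every `r > 0` and `c > 0` there is an `N`
such that for EVERY `n ≥ N`, taking `d = k = ⌈r·log₂ n⌉`, the `C(2k,k)` subcubes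
`Φ_S = {x_S = 1}`, `S ∈ powersetCard k A` (`|A| = 2k`), with the middle layer removed, are
affine subspaces of codimension exactly `k` whose union covers half the cube, each losing at
most an `n^{-r}` fraction, while the union of the survivors is both
`≤ (1 - 1/(2√k)) |U|` and `< (1 - n^{-rc}) |U|`.  (The codimension budget `(log₂ n)^q` of
Alekseev–Gaevoy (1.4) is the caller's side condition on `⌈r·log₂ n⌉`, see `side_condition_of_one_lt`.) [folklore] -/
theorem middle_layer_instance (r c : ℝ) (hr : 0 < r) (hc : 0 < c) :
    ∃ N : ℕ, 2 ≤ N ∧ ∀ n : ℕ, N ≤ n →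
    ∃ (ι : Type) (_ : Fintype ι) (Φ Φ' : ι → Set (V n)),
      (∀ i, IsAffineFlatOfCodim (Φ i) (⌈r * Real.logb 2 n⌉₊)) ∧
      2 ^ (n - 1) ≤ (⋃ i, Φ i).ncard ∧
      (∀ i, Φ' i ⊆ Φ i) ∧
      (∀ i, (1 - (n : ℝ) ^ (-r)) * ((Φ i).ncard : ℝ) ≤ ((Φ' i).ncard : ℝ)) ∧
      (((⋃ i, Φ' i).ncard : ℝ)
        ≤ (1 - 1 / (2 * Real.sqrt (⌈r * Real.logb 2 n⌉₊ : ℝ))) * ((⋃ i, Φ i).ncard : ℝ)) ∧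
      (((⋃ i, Φ' i).ncard : ℝ) < (1 - (n : ℝ) ^ (-(r * c))) * ((⋃ i, Φ i).ncard : ℝ)) := by
  obtain ⟨L₁, hL₁1, hL₁⟩ := rpow_beats_linear 1 (2 * r) one_pos
  obtain ⟨L₂, hL₂1, hL₂⟩ := rpow_beats_linear (r * c) (2 * r) (mul_pos hr hc)
  obtain ⟨N, hN2, hN⟩ := logb_threshold (max L₁ L₂)
  refine ⟨N, hN2, fun n hn => ?_⟩
  have hn2 : 2 ≤ n := le_trans hN2 hn
  have hn1 : 1 ≤ n := by omega
  have hnpos : (0 : ℝ) < n := by exact_mod_cast (by omega : 0 < n)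
  have hLmax : max L₁ L₂ ≤ Real.logb 2 n := hN n hn
  set L := Real.logb 2 n with hLdef
  have hL1 : 1 ≤ L := le_trans hL₁1 (le_trans (le_max_left _ _) hLmax)
  have hLpos : 0 < L := by linarith
  have hrL : 0 < r * L := by positivity
  set k := ⌈r * L⌉₊ with hkdef
  have hk1 : 1 ≤ k := Nat.ceil_pos.mpr hrL
  have hkR1 : (1 : ℝ) ≤ (k : ℝ) := by exact_mod_cast hk1
  have hkrL : r * L ≤ (k : ℝ) := Nat.le_ceil _
  have hkub : (k : ℝ) < r * L + 1 := Nat.ceil_lt_add_one (by positivity)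
  have hn_eq : (2 : ℝ) ^ L = (n : ℝ) := Real.rpow_logb (by norm_num) (by norm_num) hnpos
  -- threshold (ii): 2k < n
  have h2k_ltR : 2 * (k : ℝ) < (n : ℝ) := by
    have hgrow := hL₁ L (le_trans (le_max_left _ _) hLmax)
    calc 2 * (k : ℝ) < 2 * (r * L + 1) := by linarith
    _ = 2 * r * L + 2 := by ring
    _ < (2 : ℝ) ^ (1 * L) := hgrow
    _ = (n : ℝ) := by rw [one_mul, hn_eq]
  have h2kn : 2 * k ≤ n := by
    have h : ((2 * k : ℕ) : ℝ) < (n : ℝ) := by push_cast; linarith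
    exact_mod_cast h.le
  -- threshold (iv): 2√k < n^{rc}
  have hsqrtk_pos : 0 < Real.sqrt k := Real.sqrt_pos.mpr (by linarith)
  have h2s : (0 : ℝ) < 2 * Real.sqrt k := by positivity
  have hsqrt_lt : 2 * Real.sqrt k < (n : ℝ) ^ (r * c) := by
    have hgrow := hL₂ L (le_trans (le_max_right _ _) hLmax)
    have h1 : Real.sqrt k ≤ Real.sqrt (r * L + 1) := Real.sqrt_le_sqrt hkub.le
    have h2 : Real.sqrt (r * L + 1) ≤ r * L + 1 :=
      Real.sqrt_le_self_iff.mpr (Or.inr (by linarith))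
    have hnrc : (n : ℝ) ^ (r * c) = (2 : ℝ) ^ (r * c * L) := by
      rw [← hn_eq, ← Real.rpow_mul (by norm_num : (0:ℝ) ≤ 2)]
      congr 1
      ring
    calc 2 * Real.sqrt k ≤ 2 * (r * L + 1) := by
          have := le_trans h1 h2
          linarith
    _ = 2 * r * L + 2 := by ring
    _ < (2 : ℝ) ^ (r * c * L) := hgrow
    _ = (n : ℝ) ^ (r * c) := hnrc.symm
  -- threshold (iii): 2^{-k} ≤ n^{-r}
  have hnr : (2 : ℝ) ^ (-(k : ℝ)) ≤ (n : ℝ) ^ (-r) := by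
    have h1 : (n : ℝ) ^ (-r) = (2 : ℝ) ^ (-(r * L)) := by
      rw [← hn_eq, ← Real.rpow_mul (by norm_num : (0:ℝ) ≤ 2)]
      congr 1
      ring
    rw [h1]
    exact Real.rpow_le_rpow_of_exponent_le one_le_two (by linarith)
  -- the coordinate set A of size 2k and the family
  obtain ⟨A, -, hA⟩ := Finset.exists_subset_card_eq
    (show 2 * k ≤ (Finset.univ : Finset (Fin n)).card by
      rw [Finset.card_univ, Fintype.card_fin]; exact h2kn)
  have hA' : A.card = k + k := by omega
  -- shared counts
  have hUB := card_U'set_add_card_Bset A k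
  have hcastUB : ((U'set A k).card : ℝ) + ((Bset A k).card : ℝ) = ((Uset A k).card : ℝ) := by
    exact_mod_cast hUB
  have hUle : ((Uset A k).card : ℝ) ≤ (2 : ℝ) ^ n := by
    have h : (Uset A k).card ≤ 2 ^ n := by
      calc (Uset A k).card ≤ (Finset.univ : Finset (V n)).card := Finset.card_le_univ _
      _ = 2 ^ n := card_univ_V
    calc ((Uset A k).card : ℝ) ≤ ((2 ^ n : ℕ) : ℝ) := by exact_mod_cast h
    _ = (2 : ℝ) ^ n := by push_cast; ring
  have hBge : (2 : ℝ) ^ n ≤ 2 * Real.sqrt k * ((Bset A k).card : ℝ) :=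
    two_pow_le_sqrt_mul_Bset A k hA hk1
  have hsqrtU : ((Uset A k).card : ℝ) ≤ 2 * Real.sqrt k * ((Bset A k).card : ℝ) :=
    card_Uset_le_sqrt A k hA hk1
  have hBpos : (0 : ℝ) < ((Bset A k).card : ℝ) := by
    have h : 0 < (Bset A k).card := by
      rw [card_Bset, hA]
      exact Nat.mul_pos (Nat.choose_pos (by omega)) (pow_pos (by norm_num) _)
    exact_mod_cast h
  refine ⟨{S : Finset (Fin n) // S ∈ Finset.powersetCard k A}, inferInstance,
    fun i => (↑(Phi i.1) : Set (V n)), fun i => (↑(PhiP A k i.1) : Set (V n)),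
    ?_, ?_, ?_, ?_, ?_, ?_⟩
  · -- codimension exactly k
    intro i
    have h := isAffineFlatOfCodim_Phi i.1
    rwa [(Finset.mem_powersetCard.mp i.2).2] at h
  · -- the union covers at least half the cube
    rw [iUnion_Phi_eq, Set.ncard_coe_finset]
    exact card_Uset_ge A k k hA' le_rfl hn1
  · -- Φ' ⊆ Φ
    intro i
    exact Finset.coe_subset.mpr Finset.sdiff_subset
  · -- per-member deletion at most an n^{-r} fraction
    intro i
    obtain ⟨hSA, hSk⟩ := Finset.mem_powersetCard.mp i.2
    have hPhicard : (Phi i.1).card = 2 ^ (n - k) := by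
      rw [card_Phi, hSk]
    have hIntercard : (Phi i.1 ∩ Bset A k).card = 2 ^ (n - 2 * k) := by
      rw [card_Phi_inter_Bset A i.1 k hSA hSk, hA]
    have hadd := card_PhiP_add A i.1 k
    have hle : (Phi i.1 ∩ Bset A k).card ≤ (Phi i.1).card := by omega
    have hPhiP : (PhiP A k i.1).card = (Phi i.1).card - (Phi i.1 ∩ Bset A k).card := by
      omega
    rw [Set.ncard_coe_finset, Set.ncard_coe_finset, hPhiP, Nat.cast_sub hle, hPhicard,
      hIntercard]
    have hkey : ((2 ^ (n - 2 * k) : ℕ) : ℝ)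
        ≤ (n : ℝ) ^ (-r) * ((2 ^ (n - k) : ℕ) : ℝ) := by
      have e1 : ((2 ^ (n - 2 * k) : ℕ) : ℝ)
          = (2 : ℝ) ^ (-(k : ℝ)) * ((2 ^ (n - k) : ℕ) : ℝ) := by
        push_cast
        rw [← Real.rpow_natCast 2 (n - 2 * k), ← Real.rpow_natCast 2 (n - k),
          ← Real.rpow_add (by norm_num : (0:ℝ) < 2)]
        congr 1
        rw [Nat.cast_sub h2kn, Nat.cast_sub (by omega : k ≤ n)]
        push_cast
        ring
      rw [e1]
      exact mul_le_mul_of_nonneg_right hnr (by positivity)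
    have hexpand : (1 - (n : ℝ) ^ (-r)) * ((2 ^ (n - k) : ℕ) : ℝ)
        = ((2 ^ (n - k) : ℕ) : ℝ) - (n : ℝ) ^ (-r) * ((2 ^ (n - k) : ℕ) : ℝ) := by ring
    rw [hexpand]
    linarith
  · -- the display: |⋃Φ'| ≤ (1 - 1/(2√k)) |⋃Φ|
    rw [iUnion_Phi_eq, iUnion_PhiP_eq, Set.ncard_coe_finset, Set.ncard_coe_finset]
    have hdiv : ((Uset A k).card : ℝ) / (2 * Real.sqrt k) ≤ ((Bset A k).card : ℝ) := by
      rw [div_le_iff₀ h2s]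
      linarith [hsqrtU]
    have hexpand : (1 - 1 / (2 * Real.sqrt k)) * ((Uset A k).card : ℝ)
        = ((Uset A k).card : ℝ) - ((Uset A k).card : ℝ) / (2 * Real.sqrt k) := by ring
    rw [hexpand]
    linarith
  · -- the strict failure: |⋃Φ'| < (1 - n^{-rc}) |⋃Φ|
    rw [iUnion_Phi_eq, iUnion_PhiP_eq, Set.ncard_coe_finset, Set.ncard_coe_finset]
    have hrcpos : (0 : ℝ) < (n : ℝ) ^ (-(r * c)) := Real.rpow_pos_of_pos hnpos _
    have hchain : (n : ℝ) ^ (-(r * c)) * ((Uset A k).card : ℝ) < ((Bset A k).card : ℝ) := by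
      have h1 : (n : ℝ) ^ (-(r * c)) * ((Uset A k).card : ℝ)
          ≤ (n : ℝ) ^ (-(r * c)) * (2 : ℝ) ^ n :=
        mul_le_mul_of_nonneg_left hUle hrcpos.le
      have h2 : (n : ℝ) ^ (-(r * c)) * (2 : ℝ) ^ n
          ≤ (n : ℝ) ^ (-(r * c)) * (2 * Real.sqrt k * ((Bset A k).card : ℝ)) :=
        mul_le_mul_of_nonneg_left hBge hrcpos.le
      have h3 : (n : ℝ) ^ (-(r * c)) * (2 * Real.sqrt k * ((Bset A k).card : ℝ))
          < (n : ℝ) ^ (-(r * c)) * ((n : ℝ) ^ (r * c) * ((Bset A k).card : ℝ)) := by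
        apply mul_lt_mul_of_pos_left _ hrcpos
        exact mul_lt_mul_of_pos_right hsqrt_lt hBpos
      have h4 : (n : ℝ) ^ (-(r * c)) * ((n : ℝ) ^ (r * c) * ((Bset A k).card : ℝ))
          = ((Bset A k).card : ℝ) := by
        rw [← mul_assoc, ← Real.rpow_add hnpos]
        simp
      linarith
    have hexpand : (1 - (n : ℝ) ^ (-(r * c))) * ((Uset A k).card : ℝ)
        = ((Uset A k).card : ℝ) - (n : ℝ) ^ (-(r * c)) * ((Uset A k).card : ℝ) := by ring
    rw [hexpand]
    linarith

/-- Side condition for `q > 1`: past an explicit `N`, `⌈r·log₂ n⌉ ≤ (log₂ n)^q`. [folklore] -/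
lemma side_condition_of_one_lt (r q : ℝ) (hr : 0 < r) (hq : 1 < q) :
    ∃ N : ℕ, 2 ≤ N ∧ ∀ n : ℕ, N ≤ n →
      ((⌈r * Real.logb 2 n⌉₊ : ℝ)) ≤ (Real.logb 2 n) ^ q := by
  obtain ⟨N, hN2, hN⟩ := logb_threshold (max 1 ((r + 1) ^ (1 / (q - 1))))
  refine ⟨N, hN2, fun n hn => ?_⟩
  have hL := hN n hn
  set L := Real.logb 2 n with hLdef
  have hL1 : 1 ≤ L := le_trans (le_max_left _ _) hL
  have hLpos : 0 < L := by linarith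
  have hLr : (r + 1) ^ (1 / (q - 1)) ≤ L := le_trans (le_max_right _ _) hL
  have hq1 : 0 < q - 1 := by linarith
  have hbase : (0 : ℝ) ≤ (r + 1) ^ (1 / (q - 1)) :=
    (Real.rpow_pos_of_pos (by linarith) _).le
  have hpow : r + 1 ≤ L ^ (q - 1) := by
    have h1 : ((r + 1) ^ (1 / (q - 1))) ^ (q - 1) ≤ L ^ (q - 1) :=
      Real.rpow_le_rpow hbase hLr hq1.le
    rwa [← Real.rpow_mul (by linarith : (0:ℝ) ≤ r + 1), one_div,
      inv_mul_cancel₀ (ne_of_gt hq1), Real.rpow_one] at h1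
  have hceil : (⌈r * L⌉₊ : ℝ) < r * L + 1 := Nat.ceil_lt_add_one (by positivity)
  have h2 : r * L + 1 ≤ (r + 1) * L := by nlinarith
  have h3 : (r + 1) * L ≤ L ^ (q - 1) * L :=
    mul_le_mul_of_nonneg_right hpow (by linarith)
  have h4 : L ^ (q - 1) * L = L ^ q := by
    have h : L ^ (q - 1) * L ^ (1:ℝ) = L ^ ((q - 1) + 1) := (Real.rpow_add hLpos _ _).symm
    rw [Real.rpow_one] at h
    rw [h]
    congr 1
    ring
  linarith

/-- Side condition for `q = 1` and `r < 1`: past an explicit `N`,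
`⌈r·log₂ n⌉ ≤ (log₂ n)^1`. [folklore] -/
lemma side_condition_of_lt_one (r : ℝ) (hr0 : 0 < r) (hr1 : r < 1) :
    ∃ N : ℕ, 2 ≤ N ∧ ∀ n : ℕ, N ≤ n →
      ((⌈r * Real.logb 2 n⌉₊ : ℝ)) ≤ (Real.logb 2 n) ^ (1:ℝ) := by
  obtain ⟨N, hN2, hN⟩ := logb_threshold (max 1 (1 / (1 - r)))
  refine ⟨N, hN2, fun n hn => ?_⟩
  have hL := hN n hn
  set L := Real.logb 2 n with hLdef
  have hL1 : 1 ≤ L := le_trans (le_max_left _ _) hL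
  have hLr : 1 / (1 - r) ≤ L := le_trans (le_max_right _ _) hL
  have h1r : 0 < 1 - r := by linarith
  have hone : 1 ≤ (1 - r) * L := by
    rw [div_le_iff₀ h1r] at hLr
    linarith
  have hceil : (⌈r * L⌉₊ : ℝ) < r * L + 1 := Nat.ceil_lt_add_one (by positivity)
  rw [Real.rpow_one]
  nlinarith

end CubeMiddleLayer

end Literature.Combinatorics.SetFamily
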